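import Summits.ResolutionOfSingularities.ResolutionOfSingularities.Theorems.WeightedInvariantIotaOrderGenericEquimultiplicity
import Summits.ResolutionOfSingularities.ResolutionOfSingularities.Theorems.WeightedInvariantHypersurfaceLocalGameEFT4S
import Summits.ResolutionOfSingularities.ResolutionOfSingularities.Theorems.WeightedInvariantHypersurfaceLocalGameEFTDimOne
import Summits.ResolutionOfSingularities.ResolutionOfSingularities.Theorems.WeightedInvariantHypersurfaceLocalGameEFTCurveMoveChart
import HarnessLib

/-!
# The DIM-1 RUNG of the registered key H2a⁗-S `LocalWeightedDropEFT4S p` (door `HypersurfaceCentreConstruction`,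
# stmt-ResolutionOfSingularities-19897), part 4: the ∀-model open presentation (open″) `JOpenPresentationForallSing` at
# EVERY position of Krull dimension one — closed or not — for the adopted pair `(iotaOrd, (g, m) ↦ (√(g))ᵐ)`

Topic: `Summits/ResolutionOfSingularities/ResolutionOfSingularities/Theorems`. Helper for the door item
`HypersurfaceCentreConstruction` (stmt-ResolutionOfSingularities-19897, route `WeightedInvariant`), ORDER (o23c) of the door
registrar res-L1-w43-plan-1 (RULING gen 9 #4 (1), 2026-08-27T07:58:51Z: «(open″) STAYS AS TYPED (all primes `𝔪` with `A_𝔪`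
regular) … the rung simply has two sub-cases … then (o23)(b) non-closed = p511512's argument verbatim on `D(h·h₁·h₂)`»). Part 2
(`…LocalGameEFT4SDimOne.lean`, p511512) did the CLOSED positions (`𝔪` maximal) for every `ι` and `J = 𝔪ᵐ` on DVR non-units;
this file does ALL dim-1 positions for the ADOPTED CONCRETE pair, consuming the generic equimultiplicity of the order function
(`…IotaOrderGenericEquimultiplicity.lean`, (o23c)). [OURS · L1 W4.3] Replaces the role of NO printed item; NOT a statement of
the manuscript [claim: Hironaka2017, status: under-review]. AI work, weaker than expert review.

## What is proved (def-free)

* **`jOpenPresentationForallSing_dimOne_iotaOrd_jRad`** — the body of (open″) `JOpenPresentationForallSing p ι J` for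
  `(ι, J) = (iotaOrd, (g, m) ↦ (√(g))ᵐ)` at EVERY prime `𝔪` of a finite-type model `A` over a perfect field with `A_𝔪` regular of
  Krull dimension `1` and `0 ≠ F ∈ 𝔪² A_𝔪` (no maximality). With `g ∈ A` a uniformiser of `A_𝔪` (`U = (g)`, `W = (1)`),
  `h₁ ∉ 𝔪` with `h₁ · 𝔪 ⊆ (g)` (so `g ∈ 𝔮 ⇒ 𝔪 ≤ 𝔮` on `D(h₁)`), `h₂ ∉ 𝔪` making `F` a unit off `V(g)`, `s₂ ∉ 𝔪` with
  `s₂ F ∈ 𝔪²`, and `h₃ ∉ 𝔪` from GENERIC EQUIMULTIPLICITY (`GenericEquimultiplicity.exists_not_mem_forall_iotaOrd_eq`: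
  `iotaOrd (A_𝔮) F = iotaOrd (A_𝔪) F` for `𝔮 ⊇ 𝔪` in `D(h₃)`), the element `h = h₁ h₂ (h₃ s₂)` gives on `D(h)`:
  `g ∈ 𝔮 ↔ (F ∈ 𝔪_𝔮² ∧ ι(A_𝔮, F) = ι(A_𝔪, F))` (`→`: `𝔪 ≤ 𝔮`, `s₂F ∈ 𝔪² ⊆ 𝔮²`, generic equimultiplicity; `←`: off `V(g)` `F` is a
  unit), and at every `𝔮 ∋ g` of `D(h)` the PRESENTATION `(√(F·A_𝔮))ᵐ = (gᵐ)·A_𝔮` — ELEMENTARY for the adopted `J`: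
  `(F)A_𝔮 = (gⁿ)A_𝔮` (from `d t F = d b gⁿ` with `d, t, b` units at `𝔮`), and `(g)A_𝔮 = 𝔪A_𝔮` is PRIME (`h₁ · 𝔪 ⊆ (g)`,
  `𝔪 ⊆ 𝔮`), so `√(F)A_𝔮 = √((g)A_𝔮)ⁿ = (g)A_𝔮`. This is the presentation that FAILS for `J = 𝔪ᵐ` at the 2-dimensional `𝔮 ⊋ 𝔪`
  (res-type-061's `k₀[x,y]`, `𝔪 = (x)`, `F = x²`) and the reason for the registrar's adoption of `J = (√(F))ᵐ`.

## References

* V. Cossart, O. Piltant, J. Algebra 320 (2008), proof of Prop. 4.2 (generic bound of the order along a prime).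
  [cite: CossartPiltant2008, Prop. 4.2 (proof)]
* H. Matsumura, *Commutative Ring Theory*, Thm. 11.2 (regular local of dimension one = DVR). [Matsumura1987]
-/

noncomputable section

open IsLocalRing Literature.AlgebraicGeometry.Resolution
open Summit.ResolutionOfSingularities.ResolutionOfSingularities.Cruxes.HypersurfaceCentreConstruction.LocalEngine

set_option linter.dupNamespace false -- mandated namespace of this single-conjunct summit

namespace Summit.ResolutionOfSingularities.ResolutionOfSingularities.Theorems

/-- **(open″) `JOpenPresentationForallSing` at EVERY position of Krull dimension one, for the adopted pair
`(iotaOrd, (g, m) ↦ (√(g))ᵐ)`** — `k₀` perfect of characteristic `p`, `A` of finite type over `k₀`, `𝔪` ANY prime with `A_𝔪`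
regular of Krull dimension `1`, `0 ≠ F ∈ 𝔪² A_𝔪`. [OURS · L1 W4.3 · (o23c) dim-1 rung of H2a⁗-S, all positions]
[cite: CossartPiltant2008, Prop. 4.2 (proof)] -/
theorem jOpenPresentationForallSing_dimOne_iotaOrd_jRad (p : ℕ)
    (k₀ : Type) [Field k₀] [CharP k₀ p] [PerfectField k₀]
    (A : Type) [CommRing A] [Algebra k₀ A] [Algebra.FiniteType k₀ A] (𝔪 : Ideal A) [𝔪.IsPrime] (F : A)
    (hreg : IsRegularLocalRing (Localization.AtPrime 𝔪)) (hdim : ringKrullDim (Localization.AtPrime 𝔪) = 1)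
    (hF0 : algebraMap A (Localization.AtPrime 𝔪) F ≠ 0)
    (hF2 : algebraMap A (Localization.AtPrime 𝔪) F ∈ (maximalIdeal (Localization.AtPrime 𝔪)) ^ 2) :
    ∃ h : A, h ∉ 𝔪 ∧ ∃ (N : ℕ) (U : Fin N → A) (W : Fin N → ℕ), (∀ i, 0 < W i) ∧
      (∃ hU : ∀ i, algebraMap A (Localization.AtPrime 𝔪) (U i) ∈ maximalIdeal (Localization.AtPrime 𝔪),
        LinearIndependent (ResidueField (Localization.AtPrime 𝔪))
          (fun i => ((maximalIdeal (Localization.AtPrime 𝔪)).toCotangent ⟨_, hU i⟩ :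
            CotangentSpace (Localization.AtPrime 𝔪)))) ∧
      ∀ (𝔮 : Ideal A) [𝔮.IsPrime], h ∉ 𝔮 →
        ((∀ i, U i ∈ 𝔮) ↔
          (algebraMap A (Localization.AtPrime 𝔮) F ∈ (maximalIdeal (Localization.AtPrime 𝔮)) ^ 2 ∧
            iotaOrd (Localization.AtPrime 𝔮) (algebraMap A (Localization.AtPrime 𝔮) F) =
              iotaOrd (Localization.AtPrime 𝔪) (algebraMap A (Localization.AtPrime 𝔪) F))) ∧
        ((∀ i, U i ∈ 𝔮) → ∀ m : ℕ,
          ((Ideal.span {algebraMap A (Localization.AtPrime 𝔮) F}).radical) ^ m =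
            (weightedMonomialIdeal U W m).map (algebraMap A (Localization.AtPrime 𝔮))) := by
  have _unused : CharP k₀ p := inferInstance
  haveI : IsNoetherianRing A := Algebra.FiniteType.isNoetherianRing k₀ A
  classical
  haveI := hreg
  haveI := isDomain_of_isRegularLocalRing (Localization.AtPrime 𝔪)
  haveI : IsDiscreteValuationRing (Localization.AtPrime 𝔪) :=
    Literature.RingTheory.RegularLocalRing.isDiscreteValuationRing_of_ringKrullDim_eq_one hdim
  -- a uniformiser of `A_𝔪` coming from `A`
  obtain ⟨ϖ, hirr⟩ := IsDiscreteValuationRing.exists_irreducible (Localization.AtPrime 𝔪)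
  obtain ⟨⟨g, s⟩, hgs⟩ := IsLocalization.surj 𝔪.primeCompl ϖ
  have hsu : IsUnit (algebraMap A (Localization.AtPrime 𝔪) (s : A)) :=
    IsLocalization.map_units (Localization.AtPrime 𝔪) s
  have hirr' : Irreducible (algebraMap A (Localization.AtPrime 𝔪) g) := by
    have h : algebraMap A (Localization.AtPrime 𝔪) g = ϖ * algebraMap A (Localization.AtPrime 𝔪) (s : A) := hgs.symm
    rw [h]
    exact (irreducible_mul_isUnit hsu).mpr hirr
  have h𝔪S : maximalIdeal (Localization.AtPrime 𝔪) = Ideal.span {algebraMap A (Localization.AtPrime 𝔪) g} :=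
    (IsDiscreteValuationRing.irreducible_iff_uniformizer _).mp hirr'
  have hgm : algebraMap A (Localization.AtPrime 𝔪) g ∈ maximalIdeal (Localization.AtPrime 𝔪) := by
    rw [h𝔪S]; exact Ideal.mem_span_singleton_self _
  have hg𝔪 : g ∈ 𝔪 := (IsLocalization.AtPrime.to_map_mem_maximal_iff (Localization.AtPrime 𝔪) 𝔪 g).mp hgm
  -- `F = υ g'ⁿ`
  obtain ⟨n, υ, hFυ⟩ := IsDiscreteValuationRing.eq_unit_mul_pow_irreducible hF0 hirr'
  -- every `x ∈ 𝔪` is multiplied into `(g)` by some `c ∉ 𝔪`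
  have key1 : ∀ x ∈ 𝔪, ∃ c ∉ 𝔪, c * x ∈ Ideal.span {g} := by
    intro x hx
    have hxS : algebraMap A (Localization.AtPrime 𝔪) x ∈ Ideal.span {algebraMap A (Localization.AtPrime 𝔪) g} := by
      rw [← h𝔪S]
      exact (IsLocalization.AtPrime.to_map_mem_maximal_iff (Localization.AtPrime 𝔪) 𝔪 x).mpr hx
    obtain ⟨q, hq⟩ := Ideal.mem_span_singleton'.mp hxS
    obtain ⟨⟨b, t⟩, hbt⟩ := IsLocalization.surj 𝔪.primeCompl q
    have heq : algebraMap A (Localization.AtPrime 𝔪) (x * t) = algebraMap A (Localization.AtPrime 𝔪) (b * g) := by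
      rw [map_mul, map_mul, ← hq, ← hbt]
      ring
    obtain ⟨c, hc⟩ := IsLocalization.exists_of_eq (M := 𝔪.primeCompl) heq
    refine ⟨c * t, fun hmem => ?_, ?_⟩
    · rcases Ideal.IsPrime.mem_or_mem inferInstance hmem with h | h
      · exact c.2 h
      · exact t.2 h
    · rw [show (c : A) * t * x = c * (x * t) by ring, hc]
      exact Ideal.mul_mem_left _ _ (Ideal.mul_mem_left _ _ (Ideal.mem_span_singleton_self g))
  -- finite generation of `𝔪`: ONE `h₁ ∉ 𝔪` for all generators
  obtain ⟨T, hT⟩ := (IsNoetherian.noetherian 𝔪 : (𝔪 : Submodule A A).FG)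
  have hTsub : ∀ x ∈ T, x ∈ 𝔪 := fun x hx => hT ▸ Ideal.subset_span hx
  have key2 : ∀ T' : Finset A, (∀ x ∈ T', x ∈ 𝔪) → ∃ c ∉ 𝔪, ∀ x ∈ T', c * x ∈ Ideal.span {g} := by
    intro T'
    induction T' using Finset.induction_on with
    | empty => exact fun _ => ⟨1, fun h1 => Ideal.IsPrime.ne_top inferInstance ((Ideal.eq_top_iff_one _).mpr h1),
        fun x hx => absurd hx (Finset.notMem_empty x)⟩
    | insert x T'' hxT ih =>
      intro hsub
      obtain ⟨c₀, hc₀, hc₀T⟩ := ih fun y hy => hsub y (Finset.mem_insert_of_mem hy)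
      obtain ⟨c₁, hc₁, hc₁x⟩ := key1 x (hsub x (Finset.mem_insert_self x T''))
      refine ⟨c₁ * c₀, fun hmem => ?_, fun y hy => ?_⟩
      · rcases Ideal.IsPrime.mem_or_mem inferInstance hmem with h | h
        · exact hc₁ h
        · exact hc₀ h
      · rcases Finset.mem_insert.mp hy with rfl | hy'
        · rw [show c₁ * c₀ * y = c₀ * (c₁ * y) by ring]
          exact Ideal.mul_mem_left _ _ hc₁x
        · rw [mul_assoc]
          exact Ideal.mul_mem_left _ _ (hc₀T y hy')
  obtain ⟨h₁, hh₁, hh₁T⟩ := key2 T hTsub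
  -- on `D(h₁)`, a prime containing `g` contains `𝔪`
  have hV : ∀ (𝔮 : Ideal A) [𝔮.IsPrime], h₁ ∉ 𝔮 → g ∈ 𝔮 → 𝔪 ≤ 𝔮 := by
    intro 𝔮 _ hh₁𝔮 hg𝔮
    rw [← hT, Ideal.span_le]
    intro x hx
    have hcx : h₁ * x ∈ 𝔮 := (Ideal.span_singleton_le_iff_mem _).mpr hg𝔮 (hh₁T x hx)
    rcases Ideal.IsPrime.mem_or_mem inferInstance hcx with h | h
    · exact absurd h hh₁𝔮
    · exact h
  -- on `D(h₁)`, at a prime `𝔮 ⊇ 𝔪`: `(g)A_𝔮 = 𝔪A_𝔮`, a prime ideal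
  have hspan𝔮 : ∀ (𝔮 : Ideal A) [𝔮.IsPrime], h₁ ∉ 𝔮 → 𝔪 ≤ 𝔮 →
      Ideal.span {algebraMap A (Localization.AtPrime 𝔮) g} = 𝔪.map (algebraMap A (Localization.AtPrime 𝔮)) := by
    intro 𝔮 _ hh₁𝔮 h𝔪𝔮
    apply le_antisymm
    · rw [Ideal.span_singleton_le_iff_mem]
      exact Ideal.mem_map_of_mem _ hg𝔪
    · rw [Ideal.map_le_iff_le_comap, ← hT, Ideal.span_le]
      intro x hx
      rw [SetLike.mem_coe, Ideal.mem_comap, Ideal.mem_span_singleton']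
      obtain ⟨c, hc⟩ := Ideal.mem_span_singleton'.mp (hh₁T x hx)
      have hu : IsUnit (algebraMap A (Localization.AtPrime 𝔮) h₁) :=
        IsLocalization.map_units (Localization.AtPrime 𝔮) (⟨h₁, hh₁𝔮⟩ : 𝔮.primeCompl)
      refine ⟨↑hu.unit⁻¹ * algebraMap A (Localization.AtPrime 𝔮) c, ?_⟩
      rw [mul_assoc, ← map_mul, hc, map_mul, ← mul_assoc, IsUnit.val_inv_mul, one_mul]
  have hprime𝔮 : ∀ (𝔮 : Ideal A) [𝔮.IsPrime], 𝔪 ≤ 𝔮 →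
      (𝔪.map (algebraMap A (Localization.AtPrime 𝔮))).IsPrime := by
    intro 𝔮 _ h𝔪𝔮
    refine IsLocalization.isPrime_of_isPrime_disjoint 𝔮.primeCompl _ 𝔪 inferInstance ?_
    exact Set.disjoint_left.mpr fun x hx hx𝔪 => hx (h𝔪𝔮 hx𝔪)
  -- `n ≠ 0`
  have hn0 : n ≠ 0 := by
    rintro rfl
    rw [pow_zero, mul_one] at hFυ
    have hmem : algebraMap A (Localization.AtPrime 𝔪) F ∈ maximalIdeal (Localization.AtPrime 𝔪) :=
      Ideal.pow_le_self two_ne_zero hF2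
    exact (mem_nonunits_iff.mp ((IsLocalRing.mem_maximalIdeal _).mp hmem)) (hFυ ▸ υ.isUnit)
  -- `s₂ ∉ 𝔪` with `s₂ F ∈ 𝔪²`
  obtain ⟨s₂, hs₂, hs₂F⟩ :=
    OrderSemicontinuity.exists_mul_mem_pow_of_algebraMap_mem_maximalIdeal_pow_general 𝔪
      (Localization.AtPrime 𝔪) hF2
  -- generic equimultiplicity of the order along `V(𝔪)`
  obtain ⟨h₃, hh₃, hι⟩ := GenericEquimultiplicity.exists_not_mem_forall_iotaOrd_eq k₀ 𝔪 hreg F hF0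
  -- `h₂ ∉ 𝔪` making `F` a unit off `V(g)`
  obtain ⟨⟨b, t⟩, hbt⟩ := IsLocalization.surj 𝔪.primeCompl (υ : Localization.AtPrime 𝔪)
  have hbm : b ∉ 𝔪 := by
    intro hb
    have hbS : algebraMap A (Localization.AtPrime 𝔪) b ∈ maximalIdeal (Localization.AtPrime 𝔪) :=
      (IsLocalization.AtPrime.to_map_mem_maximal_iff (Localization.AtPrime 𝔪) 𝔪 b).mpr hb
    have hbu : IsUnit (algebraMap A (Localization.AtPrime 𝔪) b) := by
      rw [← hbt]
      exact υ.isUnit.mul (IsLocalization.map_units (Localization.AtPrime 𝔪) t)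
    exact (mem_nonunits_iff.mp ((IsLocalRing.mem_maximalIdeal _).mp hbS)) hbu
  have heqF : algebraMap A (Localization.AtPrime 𝔪) (F * t) = algebraMap A (Localization.AtPrime 𝔪) (b * g ^ n) := by
    rw [map_mul, map_mul, map_pow, hFυ, ← hbt]
    ring
  obtain ⟨d, hd⟩ := IsLocalization.exists_of_eq (M := 𝔪.primeCompl) heqF
  set h₂ : A := d * t * b with hh₂def
  have hh₂ : h₂ ∉ 𝔪 := by
    intro hmem
    rcases Ideal.IsPrime.mem_or_mem inferInstance hmem with h | h
    · rcases Ideal.IsPrime.mem_or_mem inferInstance h with h' | h'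
      · exact d.2 h'
      · exact t.2 h'
    · exact hbm h
  have hunitF : ∀ (𝔮 : Ideal A) [𝔮.IsPrime], h₂ ∉ 𝔮 → g ∉ 𝔮 →
      IsUnit (algebraMap A (Localization.AtPrime 𝔮) F) := by
    intro 𝔮 _ hh₂𝔮 hg𝔮
    have hd𝔮 : (d : A) ∉ 𝔮 := fun h => hh₂𝔮 (by
      rw [hh₂def, mul_assoc]; exact Ideal.mul_mem_right _ _ h)
    have ht𝔮 : (t : A) ∉ 𝔮 := fun h => hh₂𝔮 (by
      rw [hh₂def, mul_comm (d : A) t, mul_assoc]; exact Ideal.mul_mem_right _ _ h)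
    have hb𝔮 : b ∉ 𝔮 := fun h => hh₂𝔮 (Ideal.mul_mem_left _ _ h)
    have hunit : ∀ y : A, y ∉ 𝔮 → IsUnit (algebraMap A (Localization.AtPrime 𝔮) y) := fun y hy =>
      IsLocalization.map_units (Localization.AtPrime 𝔮) (⟨y, hy⟩ : 𝔮.primeCompl)
    have hprod : IsUnit (algebraMap A (Localization.AtPrime 𝔮) ((d : A) * (F * t))) := by
      rw [hd, map_mul, map_mul, map_pow]
      exact (hunit _ hd𝔮).mul ((hunit _ hb𝔮).mul ((hunit _ hg𝔮).pow n))
    rw [map_mul, map_mul] at hprod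
    exact isUnit_of_mul_isUnit_left (isUnit_of_mul_isUnit_right hprod)
  -- `(F)A_𝔮 = (gⁿ)A_𝔮` on `D(h₂)`
  have hspanF : ∀ (𝔮 : Ideal A) [𝔮.IsPrime], h₂ ∉ 𝔮 →
      Ideal.span {algebraMap A (Localization.AtPrime 𝔮) F} =
        Ideal.span {algebraMap A (Localization.AtPrime 𝔮) g ^ n} := by
    intro 𝔮 _ hh₂𝔮
    have hd𝔮 : (d : A) ∉ 𝔮 := fun h => hh₂𝔮 (by
      rw [hh₂def, mul_assoc]; exact Ideal.mul_mem_right _ _ h)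
    have ht𝔮 : (t : A) ∉ 𝔮 := fun h => hh₂𝔮 (by
      rw [hh₂def, mul_comm (d : A) t, mul_assoc]; exact Ideal.mul_mem_right _ _ h)
    have hb𝔮 : b ∉ 𝔮 := fun h => hh₂𝔮 (Ideal.mul_mem_left _ _ h)
    have hunit : ∀ y : A, y ∉ 𝔮 → IsUnit (algebraMap A (Localization.AtPrime 𝔮) y) := fun y hy =>
      IsLocalization.map_units (Localization.AtPrime 𝔮) (⟨y, hy⟩ : 𝔮.primeCompl)
    have hdt : IsUnit (algebraMap A (Localization.AtPrime 𝔮) ((d : A) * t)) := by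
      rw [map_mul]; exact (hunit _ hd𝔮).mul (hunit _ ht𝔮)
    have hdb : IsUnit (algebraMap A (Localization.AtPrime 𝔮) ((d : A) * b)) := by
      rw [map_mul]; exact (hunit _ hd𝔮).mul (hunit _ hb𝔮)
    have heq : algebraMap A (Localization.AtPrime 𝔮) ((d : A) * t) * algebraMap A (Localization.AtPrime 𝔮) F =
        algebraMap A (Localization.AtPrime 𝔮) ((d : A) * b) * algebraMap A (Localization.AtPrime 𝔮) g ^ n := by
      rw [← map_pow, ← map_mul, ← map_mul, show (d : A) * t * F = d * (F * t) by ring, hd]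
      congr 1
      ring
    apply le_antisymm
    · rw [Ideal.span_singleton_le_iff_mem, Ideal.mem_span_singleton']
      refine ⟨↑hdt.unit⁻¹ * algebraMap A (Localization.AtPrime 𝔮) ((d : A) * b), ?_⟩
      rw [mul_assoc, ← heq, ← mul_assoc, IsUnit.val_inv_mul, one_mul]
    · rw [Ideal.span_singleton_le_iff_mem, Ideal.mem_span_singleton']
      refine ⟨↑hdb.unit⁻¹ * algebraMap A (Localization.AtPrime 𝔮) ((d : A) * t), ?_⟩
      rw [mul_assoc, heq, ← mul_assoc, IsUnit.val_inv_mul, one_mul]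
  -- the data
  refine ⟨h₁ * h₂ * (h₃ * s₂), fun hmem => ?_, 1, fun _ => g, fun _ => 1, fun _ => Nat.one_pos, ⟨fun _ => hgm, ?_⟩, ?_⟩
  · rcases Ideal.IsPrime.mem_or_mem inferInstance hmem with h | h
    · rcases Ideal.IsPrime.mem_or_mem inferInstance h with h' | h'
      · exact hh₁ h'
      · exact hh₂ h'
    · rcases Ideal.IsPrime.mem_or_mem inferInstance h with h' | h'
      · exact hh₃ h'
      · exact hs₂ h'
  · -- the cotangent image of the uniformiser is non-zero
    rw [linearIndependent_unique_iff]
    intro hzero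
    rw [Ideal.toCotangent_eq_zero] at hzero
    change algebraMap A (Localization.AtPrime 𝔪) g ∈ maximalIdeal (Localization.AtPrime 𝔪) ^ 2 at hzero
    rw [h𝔪S, Ideal.span_singleton_pow, Ideal.mem_span_singleton] at hzero
    obtain ⟨c, hc⟩ := hzero
    apply hirr'.not_isUnit
    refine isUnit_iff_exists_inv.mpr ⟨c, mul_left_cancel₀ hirr'.ne_zero ?_⟩
    rw [mul_one, ← mul_assoc, ← pow_two]
    exact hc.symm
  · intro 𝔮 _ hh𝔮
    have hh₁𝔮 : h₁ ∉ 𝔮 := fun h => hh𝔮 (Ideal.mul_mem_right _ _ (Ideal.mul_mem_right _ _ h))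
    have hh₂𝔮 : h₂ ∉ 𝔮 := fun h => hh𝔮 (Ideal.mul_mem_right _ _ (Ideal.mul_mem_left _ _ h))
    have hh₃𝔮 : h₃ ∉ 𝔮 := fun h => hh𝔮 (Ideal.mul_mem_left _ _ (Ideal.mul_mem_right _ _ h))
    have hs₂𝔮 : s₂ ∉ 𝔮 := fun h => hh𝔮 (Ideal.mul_mem_left _ _ (Ideal.mul_mem_left _ _ h))
    refine ⟨⟨fun hU => ?_, fun hrhs => ?_⟩, fun hU m' => ?_⟩
    · -- `g ∈ 𝔮` ⇒ `𝔪 ≤ 𝔮` ⇒ `F ∈ 𝔪_𝔮²` and equimultiplicity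
      have h𝔪𝔮 := hV 𝔮 hh₁𝔮 (hU 0)
      exact ⟨algebraMap_mem_maximalIdeal_pow_of_mul_mem_pow 𝔮 (Localization.AtPrime 𝔮) hs₂𝔮
        (Ideal.pow_right_mono h𝔪𝔮 2 hs₂F), hι 𝔮 h𝔪𝔮 hh₃𝔮⟩
    · -- off `V(g)` the element `F` is a unit, so `F ∉ 𝔪_𝔮²`
      intro _
      by_contra hg𝔮
      have hu := hunitF 𝔮 hh₂𝔮 hg𝔮
      have hmem : algebraMap A (Localization.AtPrime 𝔮) F ∈ maximalIdeal (Localization.AtPrime 𝔮) :=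
        Ideal.pow_le_self two_ne_zero hrhs.1
      exact (mem_nonunits_iff.mp ((IsLocalRing.mem_maximalIdeal _).mp hmem)) hu
    · -- presentation at `𝔮 ⊇ 𝔪`: `√(F)A_𝔮 = √((g)A_𝔮)ⁿ = (g)A_𝔮` (prime), so `(√(F))ᵐ = (gᵐ)`
      have h𝔪𝔮 := hV 𝔮 hh₁𝔮 (hU 0)
      haveI := hprime𝔮 𝔮 h𝔪𝔮
      rw [hspanF 𝔮 hh₂𝔮, ← Ideal.span_singleton_pow, Ideal.radical_pow _ hn0, hspan𝔮 𝔮 hh₁𝔮 h𝔪𝔮,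
        Ideal.IsPrime.radical inferInstance, ← hspan𝔮 𝔮 hh₁𝔮 h𝔪𝔮, Ideal.span_singleton_pow,
        LocalGameEFTCurveMove.weightedMonomialIdeal_one_eq, Ideal.map_span, Set.image_singleton, map_pow]

end Summit.ResolutionOfSingularities.ResolutionOfSingularities.Theorems

end
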